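import Summits.Ventures.DiscreteObjects.PP12.FlagOrbitReduction
import Summits.Ventures.DiscreteObjects.PP12.FanoFiveIncReduction
import Summits.Ventures.DiscreteObjects.PP12.TwoThreeGroupReduction

/-!
# PP(12) census: the rigid endgame WITHOUT the named fact — finite statements for `p = 2, 3, 5` and plane-level statements for `p = 11, 13` (kernel; bookkeeping)
Framing: lottery ticket; floor = certified bounds/negative ranges.

Cell pub-namedobj (venture DiscreteObjects), target (M), designs gen 15. `card_collineationGroup_eq_one_v10`: `FlagOrbitReduction.card_collineationGroup_eq_one_v9`
with Janko–van Trung's `{2,3}`-group theorem (so far a NAMED FACT hypothesis `hJvT`) REPLACED by cell statements, via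
`TwoThreeGroupReduction.collineationGroupIsTwoThreeGroup_of_cells` and the order-5 orbit-matrix reduction with incidence
`FanoFiveIncReduction.noOrderFive_of_noFanoFiveIncMatrix`. Hypotheses and census status 2026-08-23 — finite statements: `h2 = NoLiftableSTD2_12_6`
(involution arrays; EMPTY outside the kernel), `h3E = NoLiftableSTD3_12_4` (order-3 elation arrays; EMPTY outside the kernel / in print), `h4, h3 =
NoFlagOrbitMatrix 4, 3` (flag sub-cells `f = 1, 4`; UNDECIDED), `h7 = NoFlagSevenOrbitMatrix` (UNDECIDED), `h10 = NoFlagTenOrbitMatrix` (EMPTY outside the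
kernel), `h5 = NoFanoFiveIncMatrix` (order 5; EMPTY outside the kernel on designs g10's structured model, which this statement types); plane-level
statements (array forms typed, reductions in print only): `h11 = NoOrderElevenOrder12`, `h13 = NoOrderThirteenOrder12`. The planar order-3 cell is the
kernel theorem `noPlanarOrder3Order12`; `p = 7, 157` and `p > 13` are kernel theorems inside `prime_mem_of_collineation_order12`.
Nothing here asserts any hypothesis. No `sorry`, no new axioms.
-/

namespace Summit.Ventures.DiscreteObjects.PP12

open Configuration Finset
open scoped Classical

open Literature.Combinatorics.Designs Summit.Ventures.DiscreteObjects.STD in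
/-- **Rigid endgame, v10 (no named fact):** the finite array / orbit-matrix statements of the cells `p = 2, 3, 5` and the plane-level statements of the
cells `p = 11, 13` force every collineation group of a projective plane of order 12 to be trivial. -/
theorem card_collineationGroup_eq_one_v10 (h2 : NoLiftableSTD2_12_6) (h3E : NoLiftableSTD3_12_4)
    (h4 : NoFlagOrbitMatrix 4) (h3 : NoFlagOrbitMatrix 3) (h7 : NoFlagSevenOrbitMatrix) (h10 : NoFlagTenOrbitMatrix)
    (h5 : NoFanoFiveIncMatrix) (h11 : NoOrderElevenOrder12) (h13 : NoOrderThirteenOrder12)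
    (P L : Type) [Membership P L] [Fintype P] [Fintype L] [ProjectivePlane P L] (h12 : ProjectivePlane.order P L = 12)
    (G : Type) [Group G] [Fintype G] [MulAction G P] [MulAction G L] (hG : IsCollineationGroup G P L) :
    Fintype.card G = 1 :=
  card_collineationGroup_eq_one_v9
    (collineationGroupIsTwoThreeGroup_of_cells (noOrderFive_of_noFanoFiveIncMatrix h5) h11 h13) h2 h3E h4 h3 h7 h10 P L h12 G hG

open Literature.Combinatorics.Designs Summit.Ventures.DiscreteObjects.STD in
/-- **The same with the uniform plain orbit-matrix statements** (`NoFlagOrbitMatrix ρ`, `ρ = 0, …, 4`, and the plain `NoFanoFiveOrbitMatrix`):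
`card_collineationGroup_eq_one_v8` without the named fact. -/
theorem card_collineationGroup_eq_one_v11 (h2 : NoLiftableSTD2_12_6) (hF0 : NoFlagOrbitMatrix 0) (hF1 : NoFlagOrbitMatrix 1)
    (hF2 : NoFlagOrbitMatrix 2) (hF3 : NoFlagOrbitMatrix 3) (hF4 : NoFlagOrbitMatrix 4)
    (h5 : NoFanoFiveOrbitMatrix) (h11 : NoOrderElevenOrder12) (h13 : NoOrderThirteenOrder12)
    (P L : Type) [Membership P L] [Fintype P] [Fintype L] [ProjectivePlane P L] (h12 : ProjectivePlane.order P L = 12)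
    (G : Type) [Group G] [Fintype G] [MulAction G P] [MulAction G L] (hG : IsCollineationGroup G P L) :
    Fintype.card G = 1 :=
  card_collineationGroup_eq_one_v8
    (collineationGroupIsTwoThreeGroup_of_cells (noOrderFive_of_noFanoFiveOrbitMatrix h5) h11 h13) h2 hF0 hF1 hF2 hF3 hF4 P L h12 G hG

end Summit.Ventures.DiscreteObjects.PP12
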